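import Mathlib
import HarnessLib
import Literature.Analysis.FluidPDE.TypeIAncientMild
import Literature.Analysis.FluidPDE.TaoClassGlue
import Literature.Analysis.FluidPDE.EnstrophyGronwall
import Literature.Analysis.FluidPDE.CheskidovShvydkoyRegularProofs
import Summits.NavierStokesRegularity.NavierStokesRegularity.Theorems.QuarterLogPincerThinCascadeDefs
import Summits.NavierStokesRegularity.NavierStokesRegularity.Theorems.QuarterLogPincerTruncationEdgeShadowing

/-!
# Route `QuarterLogPincer`, crux `TypeIQuantSubcubicExp` (stmt-NavierStokesRegularity-24077), line `truncation_edge` — towards stub T1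
# `stub_farFieldTruncation`: EXISTENCE of the shadowing solution (Tao's local theory marched under the drift bound)

Fourth piece of the typer's T1 groundwork (pub-ns-dss typer g35; helper `--supports stmt-NavierStokesRegularity-24077`), over
`…TruncationEdgeShadowing` (`exists_taoFrame_shadow`).  It supplies the EXISTENCE on `[0, F]`, `F < 1`, of a Tao-class solution from
an `H^∞` datum close to `v(−1)`, by MARCHING Tao's local `H¹` theory — the tree's PROVED fact `tao2011_smooth_local_existence_holds`
(Tao 2013 Thm. 5.4; lifespan `τ` with `A²τ ≤ c` from the `H¹` size `A`), restarted at `T_k − τ/2` and glued (`IsTaoSolutionOn.glue`) —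
the restart data having the UNIFORM budget `A = e₀ + exp(((M+1)/√(1−F))²/2)·g₀` by the energy inequality
(`IsTaoSolutionOn.lintegral_enorm_sq_le`) and the enstrophy inequality under an `L^∞` bound
(`lintegral_frobeniusNormSq_fderiv_le_mul_exp`, Lemarié-Rieusset 2016 Thm. 11.2), the `L^∞` bound being the virtual Type-I bound of
the shadowing theorem.

* `taoFrame_of_isTaoSolutionOn` — Tao-class (`IsTaoSolutionOn`) ⇒ Tao-frame (`TaoFrame`; `eLpNorm` form of the `H^k` bounds).
* `exists_isTaoSolutionOn_shadow` — the marched solution on `[0,F]` together with the shadowing and Type-I bounds.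

HONEST FRAME: existence of a finite-energy smooth solution NEAR A HYPOTHETICAL OBJECT for a finite time; T1 (its `L³` clause (ii)),
24077, 22144 and NS regularity are OPEN and untouched.
-/

noncomputable section

set_option linter.dupNamespace false

namespace Summit.NavierStokesRegularity.NavierStokesRegularity.Theorems.QuarterLogPincerTruncationEdge

open MeasureTheory Set Function Filter Real Metric
open scoped ENNReal NNReal Topology ContDiff
open Literature.Analysis Literature.Analysis.FluidPDE
open Summit.NavierStokesRegularity.NavierStokesRegularity.Cruxes.TypeIQuantSubcubicExp.ThinCascade (TaoFrame)

/-- A Tao-class solution (`IsTaoSolutionOn`) is a Tao-frame pair (`TaoFrame`: the `H^k` bounds in `eLpNorm` form). [folklore] -/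
theorem taoFrame_of_isTaoSolutionOn {T : ℝ} {u₀ : EuclideanSpace ℝ (Fin 3) → EuclideanSpace ℝ (Fin 3)}
    {u : ℝ → EuclideanSpace ℝ (Fin 3) → EuclideanSpace ℝ (Fin 3)} {p : ℝ → EuclideanSpace ℝ (Fin 3) → ℝ}
    (h : IsTaoSolutionOn T 1 u₀ u p) : TaoFrame T u p := by
  refine ⟨h.classical, fun n => ?_⟩
  obtain ⟨C, hC⟩ := h.sobolev n
  refine ⟨NNReal.sqrt C, fun t ht => ?_⟩
  have h2 : eLpNorm (iteratedFDeriv ℝ n (u t)) 2 volume =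
      (∫⁻ x, ‖iteratedFDeriv ℝ n (u t) x‖ₑ ^ 2) ^ (1 / 2 : ℝ) := by
    have := eLpNorm_eq_lintegral_rpow_enorm_toReal (f := iteratedFDeriv ℝ n (u t)) (μ := volume) (p := 2)
      two_ne_zero ENNReal.ofNat_ne_top
    rw [this]
    norm_num
  rw [h2]
  calc (∫⁻ x, ‖iteratedFDeriv ℝ n (u t) x‖ₑ ^ 2) ^ (1 / 2 : ℝ) ≤ ((C : ℝ≥0∞)) ^ (1 / 2 : ℝ) :=
        ENNReal.rpow_le_rpow (hC t ht) (by norm_num)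
    _ = (NNReal.sqrt C : ℝ≥0∞) := by
        rw [NNReal.sqrt_eq_rpow, ENNReal.coe_rpow_of_nonneg _ (by norm_num)]

/-! ## Existence of the shadow: Tao's local theory marched under the drift bound -/

/-- **EXISTENCE OF THE SHADOWING SOLUTION (T1 clauses (i)+(iii) with existence).**  With the universal `C` of
`exists_taoFrame_shadow` and `m = ⌈64C²(M+1)²⌉`: for a Type-I ancient mild `v` (`IsTypeIAncientMild M v`), a smooth divergence-free
`H^∞` datum `u₀` with `‖u₀‖²₂ ≤ e₀`, `‖∇u₀‖²₂ ≤ g₀` and `‖u₀ − v(−1)‖_∞ ≤ η`, and `0 < F < 1` with `η(2/(1−F))^m ≤ ½`, there is a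
Tao-class solution `(u, p)` on `[0, F]` from `u₀` (`IsTaoSolutionOn F 1 u₀ u p`; in particular Tao-frame, and by
`exists_taoFrame_shadow` it shadows `v` and obeys the virtual Type-I bound).  MARCHING: Tao's local `H¹` theory
(`tao2011_smooth_local_existence_holds`: lifespan `τ` with `A²τ ≤ c` from `H¹`-size `A`) restarted at `T_k − τ/2` and glued
(`IsTaoSolutionOn.glue`), the restart data having the UNIFORM budget `A = e₀ + exp(((M+1)/√(1−F))²/2)·g₀` by the energy inequality
and the enstrophy inequality under the drift bound (`lintegral_frobeniusNormSq_fderiv_le_mul_exp`). [folklore] -/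
theorem exists_isTaoSolutionOn_shadow :
    ∃ C : ℝ, 0 < C ∧ ∀ {M : ℝ} {v : ℝ → EuclideanSpace ℝ (Fin 3) → EuclideanSpace ℝ (Fin 3)}
      {u₀ : EuclideanSpace ℝ (Fin 3) → EuclideanSpace ℝ (Fin 3)} {F η e₀ g₀ : ℝ},
      IsTypeIAncientMild M v → 0 ≤ M →
      ContDiff ℝ ∞ u₀ → VectorCalculus.IsDivFree u₀ → (∀ n : ℕ, ∫⁻ x, ‖iteratedFDeriv ℝ n u₀ x‖ₑ ^ 2 < ⊤) →
      0 ≤ e₀ → (∫⁻ x, ‖u₀ x‖ₑ ^ 2 ≤ ENNReal.ofReal e₀) →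
      0 ≤ g₀ → (∫⁻ x, ENNReal.ofReal (frobeniusNormSq (fderiv ℝ u₀ x)) ≤ ENNReal.ofReal g₀) →
      0 < F → F < 1 → (∀ y, ‖u₀ y - v (-1) y‖ ≤ η) →
      η * (2 / (1 - F)) ^ ⌈64 * C ^ 2 * (M + 1) ^ 2⌉₊ ≤ 1 / 2 →
      ∃ (u : ℝ → EuclideanSpace ℝ (Fin 3) → EuclideanSpace ℝ (Fin 3)) (p : ℝ → EuclideanSpace ℝ (Fin 3) → ℝ),
        IsTaoSolutionOn F 1 u₀ u p ∧ ∀ t ∈ Icc 0 F, ∀ x,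
          ‖u t x - v (t - 1) x‖ ≤ η * (2 / (1 - t)) ^ ⌈64 * C ^ 2 * (M + 1) ^ 2⌉₊ ∧
          ‖u t x‖ ≤ (M + 1) / Real.sqrt (1 - t) := by
  obtain ⟨C, hC, hshadow⟩ := exists_taoFrame_shadow
  obtain ⟨c, hc, hloc⟩ := IsTaoSolutionOn.of_tao tao2011_smooth_local_existence_holds
  refine ⟨C, hC, ?_⟩
  intro M v u₀ F η e₀ g₀ hv hM hu₀ hdiv hH he₀0 he₀ hg₀0 hg₀ hF hF1 hη hsmall
  set m : ℕ := ⌈64 * C ^ 2 * (M + 1) ^ 2⌉₊ with hm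
  -- the uniform `H¹` budget and the step
  have hsqF : 0 < Real.sqrt (1 - F) := Real.sqrt_pos.2 (by linarith)
  set MF : ℝ := (M + 1) / Real.sqrt (1 - F) with hMF
  have hMFpos : 0 < MF := by positivity
  set A : ℝ := e₀ + Real.exp (MF ^ 2 / 2) * g₀ with hA
  have hA0 : 0 ≤ A := by positivity
  set τ : ℝ := c / (A ^ 2 + 1) with hτ
  have hτpos : 0 < τ := by positivity
  have hAτ : A ^ 2 * τ ≤ c * (1:ℝ) ^ 3 := by
    rw [one_pow, mul_one, hτ, mul_div_assoc']
    rw [div_le_iff₀ (by positivity)]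
    nlinarith [sq_nonneg A]
  -- `u 0 = u₀` is `2`-integrable, energy of `u₀`
  have hu₀m : MemLp u₀ 2 volume := by
    refine ⟨hu₀.continuous.aestronglyMeasurable, ?_⟩
    have h0 := hH 0
    have e : ∫⁻ x, ‖iteratedFDeriv ℝ 0 u₀ x‖ₑ ^ 2 = ∫⁻ x, ‖u₀ x‖ₑ ^ 2 :=
      lintegral_congr fun x => by rw [← ofReal_norm, norm_iteratedFDeriv_zero, ofReal_norm]
    rw [e] at h0
    rw [eLpNorm_eq_lintegral_rpow_enorm_toReal two_ne_zero ENNReal.ofNat_ne_top]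
    norm_num
    exact ENNReal.rpow_lt_top_of_nonneg (by norm_num) h0.ne
  have hKE : ENNReal.ofReal (2 * VectorCalculus.kineticEnergy u₀) ≤ ENNReal.ofReal e₀ := by
    rw [← eEnergy_eq_ofReal u₀ hu₀m]; exact he₀
  -- THE RESTART BOUND along any Tao-class solution on `[0,T] ⊂ [0,F]`
  have hrestart : ∀ {T : ℝ} {u : ℝ → EuclideanSpace ℝ (Fin 3) → EuclideanSpace ℝ (Fin 3)}
      {p : ℝ → EuclideanSpace ℝ (Fin 3) → ℝ}, IsTaoSolutionOn T 1 u₀ u p → 0 < T → T ≤ F →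
      ∀ a ∈ Ioc 0 T,
        (∫⁻ x, ‖u a x‖ₑ ^ 2) + (∫⁻ x, ENNReal.ofReal (frobeniusNormSq (fderiv ℝ (u a) x))) ≤
          ENNReal.ofReal A := by
    intro T u p h hT hTF a ha
    have haI : a ∈ Icc 0 T := ⟨ha.1.le, ha.2⟩
    -- energy
    have h1 : ∫⁻ x, ‖u a x‖ₑ ^ 2 ≤ ENNReal.ofReal e₀ :=
      (h.lintegral_enorm_sq_le hT zero_le_one haI).trans hKE
    -- drift bound from shadowing on `[0, T]`
    have hsmallT : η * (2 / (1 - T)) ^ m ≤ 1 / 2 := by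
      have hη0 : 0 ≤ η := (norm_nonneg _).trans (hη 0)
      have hpow : (2 / (1 - T)) ^ m ≤ (2 / (1 - F)) ^ m := by
        refine pow_le_pow_left₀ (div_nonneg zero_le_two (by linarith)) ?_ m
        exact div_le_div_of_nonneg_left zero_le_two (by linarith) (by linarith)
      exact (mul_le_mul_of_nonneg_left hpow hη0).trans hsmall
    have hη' : ∀ y, ‖u 0 y - v (-1) y‖ ≤ η := fun y => by rw [h.initial]; exact hη y
    have hdrift : ∀ t ∈ Icc 0 a, ∀ x, ‖u t x‖ ≤ MF := by
      intro t ht x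
      have h2 := (hshadow hv hM (taoFrame_of_isTaoSolutionOn h) hT (lt_of_le_of_lt hTF hF1) hη' hsmallT
        t ⟨ht.1, ht.2.trans ha.2⟩ x).2
      refine h2.trans ?_
      exact div_le_div_of_nonneg_left (by linarith) hsqF (Real.sqrt_le_sqrt (by linarith [ht.2, ha.2]))
    -- enstrophy
    have h3 := lintegral_frobeniusNormSq_fderiv_le_mul_exp one_pos hT h.classical h.sobolev h.sobolev_dt
      h.sobolev_p hMFpos ha hdrift
    rw [h.initial] at h3
    have hexp : Real.exp (MF ^ 2 * a / (2 * 1)) ≤ Real.exp (MF ^ 2 / 2) := by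
      refine Real.exp_le_exp.2 ?_
      rw [mul_one, mul_div_assoc]
      have : a ≤ 1 := by linarith [ha.2]
      nlinarith [sq_nonneg MF]
    have h4 : ∫⁻ x, ENNReal.ofReal (frobeniusNormSq (fderiv ℝ (u a) x)) ≤
        ENNReal.ofReal (Real.exp (MF ^ 2 / 2) * g₀) := by
      refine h3.trans ?_
      rw [ENNReal.ofReal_mul (Real.exp_pos _).le]
      exact mul_le_mul' (ENNReal.ofReal_le_ofReal hexp) hg₀
    calc (∫⁻ x, ‖u a x‖ₑ ^ 2) + (∫⁻ x, ENNReal.ofReal (frobeniusNormSq (fderiv ℝ (u a) x)))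
        ≤ ENNReal.ofReal e₀ + ENNReal.ofReal (Real.exp (MF ^ 2 / 2) * g₀) := add_le_add h1 h4
      _ = ENNReal.ofReal A := by rw [hA, ENNReal.ofReal_add he₀0 (by positivity)]
  -- the datum itself satisfies the budget
  have hbudget0 : (∫⁻ x, ‖u₀ x‖ₑ ^ 2) + (∫⁻ x, ENNReal.ofReal (frobeniusNormSq (fderiv ℝ u₀ x))) ≤
      ENNReal.ofReal A := by
    have hg' : ENNReal.ofReal g₀ ≤ ENNReal.ofReal (Real.exp (MF ^ 2 / 2) * g₀) := by
      refine ENNReal.ofReal_le_ofReal ?_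
      have : 1 ≤ Real.exp (MF ^ 2 / 2) := Real.one_le_exp (by positivity)
      nlinarith
    calc (∫⁻ x, ‖u₀ x‖ₑ ^ 2) + (∫⁻ x, ENNReal.ofReal (frobeniusNormSq (fderiv ℝ u₀ x)))
        ≤ ENNReal.ofReal e₀ + ENNReal.ofReal (Real.exp (MF ^ 2 / 2) * g₀) := add_le_add he₀ (hg₀.trans hg')
      _ = ENNReal.ofReal A := by rw [hA, ENNReal.ofReal_add he₀0 (by positivity)]
  -- MARCHING: `P k`: a Tao-class solution on `[0, min F ((k+2)τ/2)]`
  have hmarch : ∀ k : ℕ, ∃ (u : ℝ → EuclideanSpace ℝ (Fin 3) → EuclideanSpace ℝ (Fin 3))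
      (p : ℝ → EuclideanSpace ℝ (Fin 3) → ℝ), IsTaoSolutionOn (min F (((k:ℝ) + 2) * τ / 2)) 1 u₀ u p := by
    intro k
    induction k with
    | zero =>
      obtain ⟨u, p, h⟩ := hloc one_pos hτpos hu₀ hdiv hH hA0 hbudget0 hAτ
      refine ⟨u, p, h.mono (lt_min hF (by positivity)) ?_⟩
      have : ((0:ℕ):ℝ) + 2 = 2 := by norm_num
      rw [this, show (2:ℝ) * τ / 2 = τ by ring]
      exact min_le_right _ _
    | succ k ih =>
      obtain ⟨u, p, h⟩ := ih
      set Tk : ℝ := min F (((k:ℝ) + 2) * τ / 2) with hTk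
      have hTkpos : 0 < Tk := lt_min hF (by positivity)
      by_cases hdone : F ≤ ((k:ℝ) + 2) * τ / 2
      · -- already at `F`
        have e1 : Tk = F := min_eq_left hdone
        have e2 : min F ((((k+1:ℕ):ℝ) + 2) * τ / 2) = F := by
          refine min_eq_left (hdone.trans ?_)
          push_cast; nlinarith
        refine ⟨u, p, ?_⟩
        rw [e2]; rw [e1] at h; exact h
      · push Not at hdone
        have eTk : Tk = ((k:ℝ) + 2) * τ / 2 := min_eq_right hdone.le
        -- restart at `a = Tk − τ/2`
        set a : ℝ := Tk - τ / 2 with ha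
        have ha0 : 0 < a := by rw [ha, eTk]; have : (0:ℝ) ≤ k := k.cast_nonneg; nlinarith
        have haTk : a < Tk := by rw [ha]; linarith
        have hTkF : Tk ≤ F := min_le_left _ _
        have hbud := hrestart h hTkpos hTkF a ⟨ha0, haTk.le⟩
        have haI : a ∈ Icc 0 Tk := ⟨ha0.le, haTk.le⟩
        have hsm : ContDiff ℝ ∞ (u a) := h.classical.contDiff_velocity haI
        have hdv : VectorCalculus.IsDivFree (u a) := h.classical.divFree a haI
        have hHa : ∀ n : ℕ, ∫⁻ x, ‖iteratedFDeriv ℝ n (u a) x‖ₑ ^ 2 < ⊤ := by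
          intro n
          obtain ⟨Cn, hCn⟩ := h.sobolev n
          exact (hCn a haI).trans_lt ENNReal.coe_lt_top
        obtain ⟨u₂, p₂, h₂⟩ := hloc one_pos hτpos hsm hdv hHa hA0 hbud hAτ
        have hglue := h.glue h₂ one_pos hτpos ha0.le haTk (by rw [ha]; linarith)
        refine ⟨_, _, hglue.mono (lt_min hF (by positivity)) ?_⟩
        have : a + τ = (((k+1:ℕ):ℝ) + 2) * τ / 2 := by rw [ha, eTk]; push_cast; ring
        rw [← this]
        exact min_le_right _ _
  -- conclusion: `k` with `(k+2)τ/2 ≥ F`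
  obtain ⟨k, hk⟩ := exists_nat_ge (2 * F / τ)
  obtain ⟨u, p, h⟩ := hmarch k
  have e : min F (((k:ℝ) + 2) * τ / 2) = F := by
    refine min_eq_left ?_
    rw [div_le_iff₀ hτpos] at hk
    nlinarith
  rw [e] at h
  have hη' : ∀ y, ‖u 0 y - v (-1) y‖ ≤ η := fun y => by rw [h.initial]; exact hη y
  exact ⟨u, p, h, hshadow hv hM (taoFrame_of_isTaoSolutionOn h) hF hF1 hη' hsmall⟩

end Summit.NavierStokesRegularity.NavierStokesRegularity.Theorems.QuarterLogPincerTruncationEdge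

end
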